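import Summits.ResolutionOfSingularities.ResolutionOfSingularities.Theorems.EquisingularLiftEquisingularLiftNatTowerInvBDefs
import HarnessLib

/-!
# [OURS · L1 W4.5(b) · EL♮(3)] T23-A‴ «FIBRE PAIRS» — THE ENGINE'S STAGE INVARIANT `Tower.InvB₄` (U1 of the engine word v1): TWO LISTS — `Es` of MODEL-CARRYING
# members (datum `Tower.Exc₄`: an O-model is MANDATORY, no `NoRound` disjunct) and `Ns` of MODEL-LESS retained closed sets (definitions + pure logic)

res-L1-w45b-stub-4 g11 (T23-A / A′ / A″ / A″-S / A‴ engine owner; engine words `T23AF-ENGINE-WORD.md` 095471eb3c14cc91 (v0) and `T23Atriple-ENGINE-WORD-v1-DRAFT.md`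
3dcf936910c4d869 §1/§3 (U1); desk R24). Crux EL♮(3) = stmt-ResolutionOfSingularities-20148 (parent EL♮ stmt-…-20038). OURS; NOT a statement of any manuscript
([Hironaka2017] is a candidate under adjudication, nothing of it is asserted); AI-written, weaker than expert review. Definitions + pure-logic projections only (no `sorry`,
no instance, no notation; standard axioms). `--kind definition --supports stmt-ResolutionOfSingularities-20148 --as helper`.

WHY (engine word v1 §1). A FIBRE pair (centre `Z = Hst ∩ W` over a POINT of the carrier) needs host and witness to CARRY O-models; the B/B″ invariant's `Exc₃ := NoRound ∨ model`
marks model-less members by «finite image over F₉», which is the wrong marker (a fibre round's new surface has finite image and a model). So the A‴ stage predicate has the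
arity `R G γ T E Es Ns K`: `Es` = members with a MANDATORY model (`Exc₄`), `Ns` = model-less closed sets (fat planes of `TowerPtRamB`, members kept THROUGH a blown-up point),
the running surface `E` always model-carrying (`Exc₄ … E hE K`).
* `Tower.Exc₄` — `Exc₃`'s second disjunct alone; `Tower.StageB₄` / `Tower.InvB₄` — `StageB` / `InvB` with `Exc₄` for `E` and every `F ∈ Es`, and `IsClosed F ∧ ¬ T ⊆ F` for
  every `F ∈ Es ++ Ns`.
* pure logic: `exc₄_exc₃`, `exc₄_forgetShadow`, `invB₄_invB` (forget `Ns`; an `InvB₄` stage IS an `InvB` stage — every B″ brick stated on `InvB` applies), `invB₄_inv₃`,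
  `invB₄_of_sublist` (drop members of either list), `invB₄_cons_running`, `invB₄_ns_of_closed` (add a model-less closed set), `invB₄_final`.
-/

set_option linter.dupNamespace false -- mandated namespace `Summit.<Summit>.<Problem>` of this single-conjunct summit

noncomputable section

open CategoryTheory CategoryTheory.Limits AlgebraicGeometry TopologicalSpace Topology IsLocalRing
open Literature.AlgebraicGeometry.Resolution
open AlgebraicGeometry.Scheme.IdealSheafData

namespace Summit.ResolutionOfSingularities.ResolutionOfSingularities.Cruxes.EquisingularLiftNat.Sections.Tower

variable (O : Type) [CommRing O] (k : Type) [Field k] (θ : O →+* k)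
  (P : Scheme.{0}) (q : P ⟶ Spec (.of O)) (Y : Set P) (Ch : ∀ X' : Scheme.{0}, (X' ⟶ P) → Set X' → Prop)

/-- **The MODEL-CARRYING exceptional-surface datum `Exc₄`** = `Exc₃`'s second disjunct alone: an O-model `𝓔` with (e-i) exact reduced trace, (e-ii) stalkwise principal,
(e-iii) regular, (e-iv) off the generic point of `Y`, (e-v) the ruled datum, and the cone-shadow datum `Shadow₃` (or the shadow forgotten). No `NoRound` escape.
[OURS · L1 W4.5b · T23-A‴ engine] -/
def Exc₄ (Ruled : RuledDatum P) {F₉ : Scheme.{0}} (Z₉ : Set F₉) (hZ₉ : IsClosed Z₉) {F₁₀ : Scheme.{0}} (υ' : F₁₀ ⟶ F₉)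
    (G : Scheme.{0}) (γ : G ⟶ F₁₀) (E : Set G) (hE : IsClosed E) (K : Set G)
    (X : Scheme.{0}) (σ : X ⟶ P) (jG : G ⟶ X) : Prop :=
  ∃ 𝓔 : X.IdealSheafData,
    𝓔.comap jG = vanishingIdeal (⟨E, hE⟩ : Closeds G) ∧
    (∀ z : X, (stalkIdeal 𝓔 z).IsPrincipal) ∧ Scheme.IsRegular 𝓔.subscheme ∧
    σ '' (𝓔.support : Set X) ⊆ {p : P | ¬ IsGenericPoint p Y} ∧
    Ruled F₉ Z₉ hZ₉ F₁₀ υ' G γ E X σ jG 𝓔 ∧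
    Shadow₃ O P q G E hE K X σ jG 𝓔

/-- **The A‴ stage body at an explicit upstairs stage**: `StageB`'s context, the running surface's datum `Exc₄ … E hE K` and, for every MODEL-CARRYING member
`F ∈ Es`, the shadow-forgotten datum `Exc₄ … F hF ∅` in the SAME stage. (The model-less list `Ns` has no upstairs datum.) [OURS · L1 W4.5b · T23-A‴ engine] -/
def StageB₄ (Ruled : RuledDatum P) {F₉ : Scheme.{0}} (Z₉ : Set F₉) (hZ₉ : IsClosed Z₉) {F₁₀ : Scheme.{0}} (υ' : F₁₀ ⟶ F₉)
    (G : Scheme.{0}) (γ : G ⟶ F₁₀) (T E : Set G) (Es : List (Set G)) (K : Set G)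
    (X : Scheme.{0}) (σ : X ⟶ P) (S : Set X) (jG : G ⟶ X) (tG : G ⟶ Spec (.of k)) : Prop :=
  Ch X σ S ∧ IsIntegral X ∧ IsLocallyNoetherian X ∧ Scheme.IsRegular X ∧ IsDominant (σ ≫ q) ∧
  IsPullback jG tG (σ ≫ q) (Spec.map (CommRingCat.ofHom θ)) ∧ jG '' T = S ∧
  (∀ hE : IsClosed E, Exc₄ O P q Y Ruled Z₉ hZ₉ υ' G γ E hE K X σ jG) ∧
  (∀ F ∈ Es, ∀ hF : IsClosed F, Exc₄ O P q Y Ruled Z₉ hZ₉ υ' G γ F hF ∅ X σ jG)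

/-- **The A‴ tower-stage invariant `Tower.InvB₄ … G γ T E Es Ns K`** (arity of the T23-A‴ stage predicate): `InvB`'s context and downstairs bookkeeping,
`IsClosed F ∧ ¬ T ⊆ F` for every member of BOTH lists, and ONE upstairs stage carrying `StageB₄` (models for `E` and all of `Es`; nothing for `Ns`).
[OURS · L1 W4.5b · T23-A‴ engine] -/
def InvB₄ (Ruled : RuledDatum P) (F₉ : Scheme.{0}) (Z₉ : Set F₉) (hZ₉ : IsClosed Z₉) (F₁₀ : Scheme.{0}) (υ' : F₁₀ ⟶ F₉)
    (G : Scheme.{0}) (γ : G ⟶ F₁₀) (T E : Set G) (Es Ns : List (Set G)) (K : Set G) : Prop :=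
  IsBlowup υ' (vanishingIdeal (⟨Z₉, hZ₉⟩ : Closeds F₉)) ∧ Z₉.Infinite ∧
  IsIntegral G ∧ IsClosed T ∧ IsIrreducible T ∧ IsClosed E ∧ ¬ T ⊆ E ∧
  (∀ F ∈ Es, IsClosed F ∧ ¬ T ⊆ F) ∧ (∀ F ∈ Ns, IsClosed F ∧ ¬ T ⊆ F) ∧
  ∃ (X : Scheme.{0}) (σ : X ⟶ P) (S : Set X) (jG : G ⟶ X) (tG : G ⟶ Spec (.of k)),
    StageB₄ O k θ P q Y Ch Ruled Z₉ hZ₉ υ' G γ T E Es K X σ S jG tG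

/-! ## Pure-logic projections -/

/-- `Exc₄ ⇒ Exc₃` (a model-carrying datum is a B-datum). [OURS · pure logic] -/
theorem exc₄_exc₃ (Ruled : RuledDatum P) {F₉ : Scheme.{0}} {Z₉ : Set F₉} {hZ₉ : IsClosed Z₉} {F₁₀ : Scheme.{0}} {υ' : F₁₀ ⟶ F₉}
    {G : Scheme.{0}} {γ : G ⟶ F₁₀} {E : Set G} {hE : IsClosed E} {K : Set G} {X : Scheme.{0}} {σ : X ⟶ P} {jG : G ⟶ X}
    (h : Exc₄ O P q Y Ruled Z₉ hZ₉ υ' G γ E hE K X σ jG) : Exc₃ O P q Y Ruled Z₉ hZ₉ υ' G γ E hE K X σ jG :=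
  Or.inr h

/-- Forgetting the cone shadow in a model-carrying datum (`K ↦ ∅`). [OURS · pure logic] -/
theorem exc₄_forgetShadow (Ruled : RuledDatum P) {F₉ : Scheme.{0}} {Z₉ : Set F₉} {hZ₉ : IsClosed Z₉} {F₁₀ : Scheme.{0}} {υ' : F₁₀ ⟶ F₉}
    {G : Scheme.{0}} {γ : G ⟶ F₁₀} {E : Set G} {hE : IsClosed E} {K : Set G} {X : Scheme.{0}} {σ : X ⟶ P} {jG : G ⟶ X}
    (h : Exc₄ O P q Y Ruled Z₉ hZ₉ υ' G γ E hE K X σ jG) : Exc₄ O P q Y Ruled Z₉ hZ₉ υ' G γ E hE ∅ X σ jG := by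
  obtain ⟨𝓔, h1, h2, h3, h4, h5, -⟩ := h
  exact ⟨𝓔, h1, h2, h3, h4, h5, Or.inl rfl⟩

/-- `Tower.InvB₄ ⇒ Tower.InvB` (forget the model-less list; every B/B″ brick stated on `Tower.InvB` applies to an A‴ stage). [OURS · pure logic] -/
theorem invB₄_invB (Ruled : RuledDatum P) (F₉ : Scheme.{0}) (Z₉ : Set F₉) (hZ₉ : IsClosed Z₉) (F₁₀ : Scheme.{0}) (υ' : F₁₀ ⟶ F₉)
    (G : Scheme.{0}) (γ : G ⟶ F₁₀) (T E : Set G) (Es Ns : List (Set G)) (K : Set G)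
    (h : InvB₄ O k θ P q Y Ch Ruled F₉ Z₉ hZ₉ F₁₀ υ' G γ T E Es Ns K) : InvB O k θ P q Y Ch Ruled F₉ Z₉ hZ₉ F₁₀ υ' G γ T E Es K := by
  obtain ⟨h1, h2, h3, h4, h5, h6, h7, hEs, -, X, σ, S, jG, tG, hCh, hX, hXn, hXr, hdom, hsq, hTS, hE, hF⟩ := h
  exact ⟨h1, h2, h3, h4, h5, h6, h7, hEs, X, σ, S, jG, tG, hCh, hX, hXn, hXr, hdom, hsq, hTS,
    fun hEcl => exc₄_exc₃ O P q Y Ruled (hE hEcl), fun F hFmem hFcl => exc₄_exc₃ O P q Y Ruled (hF F hFmem hFcl)⟩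

/-- `Tower.InvB₄ ⇒ Tower.Inv₃` for the running surface. [OURS · pure logic] -/
theorem invB₄_inv₃ (Ruled : RuledDatum P) (F₉ : Scheme.{0}) (Z₉ : Set F₉) (hZ₉ : IsClosed Z₉) (F₁₀ : Scheme.{0}) (υ' : F₁₀ ⟶ F₉)
    (G : Scheme.{0}) (γ : G ⟶ F₁₀) (T E : Set G) (Es Ns : List (Set G)) (K : Set G)
    (h : InvB₄ O k θ P q Y Ch Ruled F₉ Z₉ hZ₉ F₁₀ υ' G γ T E Es Ns K) : Inv₃ O k θ P q Y Ch Ruled F₉ Z₉ hZ₉ F₁₀ υ' G γ T E K :=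
  invB_inv₃ O k θ P q Y Ch Ruled F₉ Z₉ hZ₉ F₁₀ υ' G γ T E Es K (invB₄_invB O k θ P q Y Ch Ruled F₉ Z₉ hZ₉ F₁₀ υ' G γ T E Es Ns K h)

/-- Dropping members from either list (any sub-families, as the A‴ steps allow). [OURS · pure logic] -/
theorem invB₄_of_sublist (Ruled : RuledDatum P) (F₉ : Scheme.{0}) (Z₉ : Set F₉) (hZ₉ : IsClosed Z₉) (F₁₀ : Scheme.{0}) (υ' : F₁₀ ⟶ F₉)
    (G : Scheme.{0}) (γ : G ⟶ F₁₀) (T E : Set G) (Es Es' Ns Ns' : List (Set G)) (K : Set G)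
    (h : InvB₄ O k θ P q Y Ch Ruled F₉ Z₉ hZ₉ F₁₀ υ' G γ T E Es Ns K) (hEs : ∀ F ∈ Es', F ∈ Es) (hNs : ∀ F ∈ Ns', F ∈ Ns) :
    InvB₄ O k θ P q Y Ch Ruled F₉ Z₉ hZ₉ F₁₀ υ' G γ T E Es' Ns' K := by
  obtain ⟨h1, h2, h3, h4, h5, h6, h7, hEsB, hNsB, X, σ, S, jG, tG, hCh, hX, hXn, hXr, hdom, hsq, hTS, hE, hF⟩ := h
  exact ⟨h1, h2, h3, h4, h5, h6, h7, fun F hF' => hEsB F (hEs F hF'), fun F hF' => hNsB F (hNs F hF'), X, σ, S, jG, tG, hCh, hX, hXn, hXr, hdom,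
    hsq, hTS, hE, fun F hF' hFcl => hF F (hEs F hF') hFcl⟩

/-- Retaining the running surface itself among the model-carrying members (shadow forgotten). [OURS · pure logic] -/
theorem invB₄_cons_running (Ruled : RuledDatum P) (F₉ : Scheme.{0}) (Z₉ : Set F₉) (hZ₉ : IsClosed Z₉) (F₁₀ : Scheme.{0}) (υ' : F₁₀ ⟶ F₉)
    (G : Scheme.{0}) (γ : G ⟶ F₁₀) (T E : Set G) (Es Ns : List (Set G)) (K : Set G)
    (h : InvB₄ O k θ P q Y Ch Ruled F₉ Z₉ hZ₉ F₁₀ υ' G γ T E Es Ns K) :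
    InvB₄ O k θ P q Y Ch Ruled F₉ Z₉ hZ₉ F₁₀ υ' G γ T E (E :: Es) Ns K := by
  obtain ⟨h1, h2, h3, h4, h5, h6, h7, hEsB, hNsB, X, σ, S, jG, tG, hCh, hX, hXn, hXr, hdom, hsq, hTS, hE, hF⟩ := h
  refine ⟨h1, h2, h3, h4, h5, h6, h7, ?_, hNsB, X, σ, S, jG, tG, hCh, hX, hXn, hXr, hdom, hsq, hTS, hE, ?_⟩
  · intro F hFmem
    rcases List.mem_cons.mp hFmem with rfl | hFmem
    · exact ⟨h6, h7⟩
    · exact hEsB F hFmem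
  · intro F hFmem hFcl
    rcases List.mem_cons.mp hFmem with rfl | hFmem
    · exact exc₄_forgetShadow O P q Y Ruled (hE hFcl)
    · exact hF F hFmem hFcl

/-- Adding a MODEL-LESS closed set not containing `T` to `Ns` (the fat plane of a ram point step; a member kept through a blown-up point). [OURS · pure logic] -/
theorem invB₄_ns_cons (Ruled : RuledDatum P) (F₉ : Scheme.{0}) (Z₉ : Set F₉) (hZ₉ : IsClosed Z₉) (F₁₀ : Scheme.{0}) (υ' : F₁₀ ⟶ F₉)
    (G : Scheme.{0}) (γ : G ⟶ F₁₀) (T E : Set G) (Es Ns : List (Set G)) (K N : Set G)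
    (h : InvB₄ O k θ P q Y Ch Ruled F₉ Z₉ hZ₉ F₁₀ υ' G γ T E Es Ns K) (hN : IsClosed N) (hTN : ¬ T ⊆ N) :
    InvB₄ O k θ P q Y Ch Ruled F₉ Z₉ hZ₉ F₁₀ υ' G γ T E Es (N :: Ns) K := by
  obtain ⟨h1, h2, h3, h4, h5, h6, h7, hEsB, hNsB, hrest⟩ := h
  refine ⟨h1, h2, h3, h4, h5, h6, h7, hEsB, ?_, hrest⟩
  intro F hFmem
  rcases List.mem_cons.mp hFmem with rfl | hFmem
  · exact ⟨hN, hTN⟩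
  · exact hNsB F hFmem

/-- **The A‴ driver's (final) clause from `Tower.InvB₄`.** [OURS · pure logic] -/
theorem invB₄_final (Ruled : RuledDatum P) (F₉ : Scheme.{0}) (Z₉ : Set F₉) (hZ₉ : IsClosed Z₉) (F₁₀ : Scheme.{0}) (υ' : F₁₀ ⟶ F₉)
    (G : Scheme.{0}) (γ : G ⟶ F₁₀) (T E : Set G) (Es Ns : List (Set G)) (K : Set G)
    (h : InvB₄ O k θ P q Y Ch Ruled F₉ Z₉ hZ₉ F₁₀ υ' G γ T E Es Ns K) :
    ∃ (X₉ : Scheme.{0}) (σ₉ : X₉ ⟶ P) (S₉ : Set X₉) (j₉ : G ⟶ X₉) (t₉ : G ⟶ Spec (.of k)),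
      Ch X₉ σ₉ S₉ ∧ IsIntegral X₉ ∧ IsLocallyNoetherian X₉ ∧ Scheme.IsRegular X₉ ∧ IsDominant (σ₉ ≫ q) ∧
      IsPullback j₉ t₉ (σ₉ ≫ q) (Spec.map (CommRingCat.ofHom θ)) ∧ j₉ '' T = S₉ ∧ IsClosed T ∧ IsIrreducible T ∧ IsIntegral G :=
  invB_final O k θ P q Y Ch Ruled F₉ Z₉ hZ₉ F₁₀ υ' G γ T E Es K (invB₄_invB O k θ P q Y Ch Ruled F₉ Z₉ hZ₉ F₁₀ υ' G γ T E Es Ns K h)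

end Summit.ResolutionOfSingularities.ResolutionOfSingularities.Cruxes.EquisingularLiftNat.Sections.Tower

end
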